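/-
Origin: expansion seat `planner-pub-hodgecm-pv11-g9-0`, handover REPLACE (DOC-ONLY; tree e0ea3661 = r29 cd992937 + header); ONE rewrite as r29: `^import Pv11g9\.` -> `import HodgeCM.Automorphic.` (x1: EndStateInvariance) ; in place; comment-stripped residue md5 130355ed identical to r29 source (`HOME/pub-hodgecm-pv11-g9/lean/Pv11g9/PrintedTorusEndState.lean`, md5 0c0608fa, 690 lines);
landed by the gen-8 packager in gate run 30 REPLACES the earlier landed copy of `HodgeCM/PerL34/PrintedTorusEndState.lean` (import ^import Pv11g9\.EndStateInvariance[ \t]*$→import HodgeCM.Automorphic.EndStateInvariance ×1).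
-/
/-
Copyright: pub-hodgecm cell, unit pub-hodgecm-pv11-g9 (DAG-NODE PROVER #11, gen 9), node #1. Mathlib + tree only.
Origin / target: `HOME/pub-hodgecm-pv11-g9/lean/Pv11g9/PrintedTorusEndState.lean` → `HodgeCM/PerL34/PrintedTorusEndState.lean`
(imports: TREE modules `HodgeCM.PerL34.PrintedTorusMatch` (pv11-g8, RUN 28), `HodgeCM.PerL34.FockPrintBridge` (pv12-g7,
RUN 28), `HodgeCM.Automorphic.SignRecipeEndStateFree` (prl1-g5, RUN 27), and this seat's node #2 under its WIP name
`Pv11g9.EndStateInvariance` ↦ `HodgeCM.Automorphic.EndStateInvariance` (ONE rewrite); lands after RUN 28 and after node #2).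
-/
import Summits.HodgeConjecture.HodgeCM.PerL34.PrintedTorusMatch_2
import Summits.HodgeConjecture.HodgeCM.PerL34.FockPrintBridge
import Summits.HodgeConjecture.HodgeCM.Automorphic.SignRecipeEndStateFree
import Summits.HodgeConjecture.HodgeCM.Automorphic.EndStateInvariance

/-!
# N29 (Lemma 4.1(c)) on the END STATE: the torus half is a kernel theorem; `Open_occ` of the end-state theta
# model from TORUS-FREE printed analytic data

PerL v5 (tex blob d912a121, LEMMAS.md §0), verbatim: Thm 3.7 hypothesis (†), ll. 442–443 "and that for every isotypic
component $\hat\sigma$ and $\Phi\in\cS^\kappa$ with $\mathcal T_\Phi|_{\hat\sigma}\ne0$ the type $w$ occurs in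
$\sigma_\infty|_{T}$ and $w'$ in $\sigma_\infty|_{T'}$ (Lemma~\ref{lem:arch}(c))"; Lemma 4.1(c), ll. 488–490 "If
$\hat\sigma\subset L^2([\U(W)])$ is an isotypic component (of type $\sigma=\sigma_\infty\otimes\sigma_f$) with
$\mathcal T_\Phi|_{\hat\sigma}\ne0$ for some $\Phi\in\cS^\kappa$, then for every $b$ the restriction of $\sigma_b$ to $T_b$
contains $w_b$ and its restriction to $T'_b$ contains $w'_b$."; its proof, ll. 485–486 "a vector $\phi^0_b$ on which
$T_b=\U(W_{1,b})\times\U(W_{2,b})$ acts by the character $-w_b:=(-e_b(\Psi_1),-e_b(\Psi_2))$" and ll. 522–523 "so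
$Pv\ne0$: $\hat\sigma$, hence $\sigma$, contains a non-zero vector on which $T_b$ acts by $w_b$. Likewise $w'_b$."
In the tree this is the OPEN input `ThetaModel.Open_occ` (carver `Arch.N29_occ`, `N29_iff : N29_occ T ↔ T.Open_occ` by
`Iff.rfl`; typed in the all-places form consumed by Thm 3.7), one of the EIGHT `NonDesignInputs` of the binder-minimal
end states `Assembly.perL_ofAdelicTorusCompactRest` (prl1-g4) / `Assembly.perL_ofSignRecipe₀` (prl1-g5).

What the torus/seesaw lane had reached (RUN 28): pv12-g7's S4 consumer record `ArchC.PrintedAnalyticSide C D P RP kind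
lam hlam vac` (= pv12-g4's `FockAnalyticBridge` with the four Fock fields `pl, w, w_norm, w_loc` supplied by the printed
places) still carries TWO torus-side fields — the chart torus `ιT : T_print(L₀ ⊗ ℝ) →* G` and the occurrence inference
`wOccurs_of_eigenvector` — and pv11-g8's `PrintedTorusMatch` proved the latter on prl1's carriers for the canonical chart
`printedTorusHom` and the PINNED vacuum characters `pinnedVacs kind m₁ m₂` (checked on the literal end state in a
non-landed file only).  This leaf finishes the bookkeeping BY NAME, on the literal end-state theta model:

* §1 `ArchC.TorusFreeAnalyticSide C P RP kind lam hlam vac ιT` — `PrintedAnalyticSide` MINUS its two torus fields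
  (`ιT` becomes a PARAMETER, `wOccurs_of_eigenvector` is dropped); every remaining field verbatim (they speak about the
  core `C`, the Hahn–Banach points `P`, `𝒮^κ` and the printed places only).  `toSide` rebuilds pv12-g7's record from a
  proof of the dropped field; `ofSide` / `toSide_ofSide` show nothing else was lost.  `ArchC.ModelAnalyticSide` —
  the same MINUS the continuity field `cont` and the N21 field `invariance` (TWENTY fields), which a kernel model over
  quotient models discharges by itself (node #2 `EndStateInvariance`); `toTorusFree` / `ofTorusFree` / `toTorusFree_ofTorusFree`.
* §2 ON THE END STATE `T∘ := ThetaModel.ofRegCarrier (C.rtc R12 R34) hA` of an adelic torus core `C : U.AdelicTorusCore hP`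
  with residual blocks `R12`, `R34` (prl1-g4 `AdelicTorusCompactInput`; `hA` arbitrary, the end states use
  `(C.analyticKM R12 R34).toAnalytic`): the canonical charts `chart12` / `chart34` (`printedTorusHom` through
  `jT₁₂Model` / `jT₃₄Model`), and the dropped field as THEOREMS `t12_wOccurs_of_printedEigenvector` /
  `t34_wOccurs_of_printedEigenvector` whose conclusions are literally `(T∘.t12 V c).wOccurs i` / `(T∘.t34 V c).wOccurs i`
  (pv11-g8's `RepTorusCarrier.toTorusData_wOccurs_of_printedEigenvector` with `e := id` and both side conditions `rfl`).
* §3 `Open_occ_of_printedCores` — **`T∘.Open_occ` (N29, both torus sides) from, per good context, ONE torus-free,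
  N21-free printed analytic side per pair** (`PrintedCore12` / `PrintedCore34`: a kind map, non-zero scalings and a
  twenty-field `ModelAnalyticSide` over `T∘.core V c` at the CANONICAL points `C.pointedCore` (node #2) and the
  canonical chart with the pinned vacuum characters of the typed weights `(R12 V c).m₁, (R12 V c).m₂` /
  `(R34 V c).m₁, (R34 V c).m₂`; `toSide` supplies `cont`, `invariance` from node #2 and the occurrence field from §2);
  `N29_occ_of_printedCores` the carver's name;
  §4 the same two statements for prl1-g5's sign-recipe end state `C₀.thetaModel h d12 d34` (`C₀ : U.AdelicThetaCore hP`,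
  in particular `U.AdelicThetaCore₀`), by `rfl`-specialisation.
* §5 the binder-minimal END STATES with `occ` so discharged: `Assembly.realisationExists_ofSignRecipe₀_printedCores`,
  `Assembly.perL_ofSignRecipe₀_printedCores : … → U.PerL`, `Assembly.COR_CM_endState_ofSignRecipe₀_printedCores : … → U.HC_CM`
  — prl1-g5's `…_ofSignRecipe₀` with the `occ` field of `NonDesignInputs` built by §4; binders `M`, `h`,
  `C : U.AdelicThetaCore₀`, `d12 d34`, the SEVEN other non-design theta inputs by name, the printed cores `A12`, `A34`
  of the good contexts, Hodge–Riemann (and the five [QW8]-side facts for COR-CM).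

Net effect on the ledger of open inputs (LEMMAS §2 v16 (3)/(4)): in the end state the input `occ` (N29) no longer has a
torus-side component, and its N21 component, its continuity clause (ll. 518–520) and its evaluation points (l. 514) are
theorems / canonical (node #2) — what remains of Lemma 4.1(c) there is the twenty-field MODEL analytic side over the
model's own core (`ModelAnalyticSide`: a linear structure on `𝒮^κ` making `Φ ↦ 𝒯_Φ` linear, pure tensors `φ ⊗ Φ_f` and
their density, the Weil action of `T_b` on `φ ⊗ Φ_f` with the PINNED vacuum character = N26's printed dictionary
`e_b(Ψ_i)`, real directions / ladder span / derivatives (D5), smooth vectors (D7)), i.e. constraints on the free data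
`C.wm` of the model.  Nothing cited, nothing posited; no statement of PerL / QW8 / the 2001 programme is a hypothesis.
-/

set_option autoImplicit false

noncomputable section

open scoped InnerProductSpace

namespace HodgeCM
namespace PerL34
namespace ArchC

open HodgeCM.Prior.Perl34File HodgeCM.Prior.Perl34File.Perl34
open HodgeCM.PerL34.Fock HodgeCM.PerL34.Fock.PrintDict

/-! ## §1  The S4 analytic side with NO torus field -/

section TorusFree

variable {H HG CG G SK SigIdx SigIdxG : Type*}
variable [NormedAddCommGroup H] [InnerProductSpace ℂ H] [CompleteSpace H]
variable [NormedAddCommGroup HG] [InnerProductSpace ℂ HG] [CompleteSpace HG]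
variable [NormedAddCommGroup CG] [NormedSpace ℂ CG]
variable [Group G] [TopologicalSpace G] [TopologicalSpace SK]

/-- **The S4 input over the printed places with the chart torus FIXED and NO occurrence field**: pv12-g7's
`PrintedAnalyticSide C D P RP kind lam hlam vac` minus `ιT` (now the parameter `ιT`) and minus
`wOccurs_of_eigenvector`; every other field verbatim (none of them mentions the torus datum `D`). -/
structure TorusFreeAnalyticSide (C : IsolationCore H HG CG G SK SigIdx SigIdxG) (P : C4a.PointedCore C)
    (RP : Type) [Fintype RP] [DecidableEq RP] (kind : RP → PlaceKind) (lam : RP → ℂ)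
    (hlam : ∀ b, lam b ≠ 0) (vac : RP → (Circle × Circle →* Circle))
    (ιT : (printPlaces RP kind lam hlam vac).Tg →* G) where
  /-- [SETUP D4] the additive group structure of 𝒮^κ. -/
  [instSKacg : AddCommGroup SK]
  /-- [SETUP D4] the ℂ-vector-space structure of 𝒮^κ. -/
  [instSKmod : Module ℂ SK]
  /-- [SETUP D4] Φ ↦ 𝒯_Φ is additive. -/
  TΦc_add : ∀ Φ Ψ : SK, C.TΦc (Φ + Ψ) = C.TΦc Φ + C.TΦc Ψ
  /-- [SETUP D4] Φ ↦ 𝒯_Φ is homogeneous. -/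
  TΦc_smul : ∀ (c : ℂ) (Φ : SK), C.TΦc (c • Φ) = c • C.TΦc Φ
  /-- [SETUP D4] Φ ↦ 𝒯_Φ(v)(g) is continuous on 𝒮^κ. -/
  cont : ∀ (p : P.Pt) (v : H), Continuous fun Φ : SK => P.evalPt p (C.TΦc Φ v)
  /-- [SETUP D4] index of the fixed data at the other places: Φ_f ∈ 𝒮((V₃⊗W)(𝔸_f)). -/
  FinIdx : Type
  /-- [SETUP D4] the pure tensor φ ↦ φ ⊗ Φ_f ∈ 𝒮^κ, linear in φ ∈ 𝓕^κ_∞ = ⊗_b 𝓕^{κ_b}_b (printed places). -/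
  ins : FinIdx → (printPlaces RP kind lam hlam vac).F →ₗ[ℂ] SK
  /-- [SETUP D4/D5] the pure tensors span a dense subspace of 𝒮^κ (Reed–Simon I Thm V.13). -/
  dense : Dense (Submodule.span ℂ
    (Set.range fun q : FinIdx × (printPlaces RP kind lam hlam vac).F => ins q.1 q.2) : Set SK)
  /-- [SETUP D4] ω(t)(φ ⊗ Φ_f) = (ω_∞(t)φ) ⊗ Φ_f with ω_∞|_T = ⊗_b ω_{W,b}|_{T_b} (= `pl.ωT`, printed scalings; with
  `vac` pinned this IS N26's dictionary `e_b(Ψ_i)` for the genuine action). -/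
  omg_ins : ∀ (f : FinIdx) (t : (printPlaces RP kind lam hlam vac).Tg) (φ : (printPlaces RP kind lam hlam vac).F),
    C.omg (ιT t) (ins f φ) = ins f ((printPlaces RP kind lam hlam vac).ωT t φ)
  /-- [NODE N21] 𝒯_{ω(h)Φ}(R(h)v) = 𝒯_Φ(v). -/
  invariance : ∀ (h : G) (Φ : SK) (v : H), C.TΦc (C.omg h Φ) (C.R h v) = C.TΦc Φ v
  /-- [SETUP D5] index of a family of REAL directions X_j ∈ 𝔲(W)(L₀⊗ℝ). -/
  ιR : Type
  /-- [SETUP D5] ω_∞(X_j) on 𝓕^κ_∞. -/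
  XR : ιR → (printPlaces RP kind lam hlam vac).F →ₗ[ℂ] (printPlaces RP kind lam hlam vac).F
  /-- [SETUP D4] the one-parameter subgroups e_j(s) = exp(sX_j). -/
  e : ιR → ℝ → G
  /-- [SETUP D4] e_j(0) = 1. -/
  he : ∀ j, e j 0 = 1
  /-- [SETUP D5] every printed slot / ladder operator is a ℂ-combination of the real directions (Folland Prop. (4.49)). -/
  ladder_span : ∀ k : (printPlaces RP kind lam hlam vac).ιX,
    (printPlaces RP kind lam hlam vac).X k ∈ Submodule.span ℂ (Set.range XR)
  /-- [SETUP D5′, FRÉCHET-SMOOTH VECTOR composed with the bounded linear Φ ↦ 𝒯_Φ(·)(g)] derivative of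
  s ↦ 𝒯_{ω(e_j s)(φ⊗Φ_f)}(·)(g) at 0 with VALUE 𝒯_{(X_jφ)⊗Φ_f}(·)(g).  WARRANT (adv2g34-O14 / adv2g35-O14-R): Poulsen 1972
  Prop. 1.2 + Thm. 1.2 p. 93; (D_∞(μ|Mp), Goodman) = (𝒮, Schwartz) by Folland 1989 p. 165 (4.47) + Reed–Simon I App. to
  §V.3 Lemmas 1–2 / Thm. V.13 pp. 141–143 + Folland Thm. (4.45); Folland (4.45)/(4.49) for the VALUE dω(X_j) only. -/
  hF : ∀ (j : ιR) (f : FinIdx) (φ : (printPlaces RP kind lam hlam vac).F) (p : P.Pt),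
    HasDerivAt (fun s : ℝ => C4a.pointFunctional C P (C.omg (e j s) (ins f φ)) p)
      (C4a.pointFunctional C P (ins f (XR j φ)) p) 0
  /-- [SETUP D7] the smooth (Gårding) vectors of σ̂_i (Getz–Hahn Prop. 4.2.3). -/
  Sm : SigIdx → Set H
  /-- [SETUP D7] smooth vectors lie in σ̂_i. -/
  Sm_sub : ∀ i, Sm i ⊆ (C.hatσ i : Set H)
  /-- [SETUP D7] smooth vectors are dense in σ̂_i. -/
  Sm_dense : ∀ i, (C.hatσ i : Set H) ⊆ closure (Sm i)
  /-- [SETUP D7] the derived action dR(X_j) on smooth vectors (Getz–Hahn Lemma 4.2.2). -/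
  YR : ιR → H → H
  /-- [SETUP D7] smooth vectors are stable under dR(X_j). -/
  YR_mem : ∀ (j : ιR) (i : SigIdx), ∀ v ∈ Sm i, YR j v ∈ Sm i
  /-- [SETUP D7] s ↦ R(e_j s)v is differentiable at 0 with derivative dR(X_j)v on smooth vectors. -/
  hH : ∀ (j : ιR) (i : SigIdx), ∀ v ∈ Sm i, HasDerivAt (fun s : ℝ => C.R (e j s) v) (YR j v) 0

namespace TorusFreeAnalyticSide

variable {C : IsolationCore H HG CG G SK SigIdx SigIdxG} {P : C4a.PointedCore C}
variable {RP : Type} [Fintype RP] [DecidableEq RP] {kind : RP → PlaceKind} {lam : RP → ℂ} {hlam : ∀ b, lam b ≠ 0}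
  {vac : RP → (Circle × Circle →* Circle)} {ιT : (printPlaces RP kind lam hlam vac).Tg →* G}

/-- **pv12-g7's `PrintedAnalyticSide` REBUILT** from the torus-free side, a torus datum `D` and a proof of the one
dropped field (the S4 occurrence inference for eigenvectors of the chart torus `ιT` with the printed weight). -/
def toSide (A : TorusFreeAnalyticSide C P RP kind lam hlam vac ιT) (D : TorusData C)
    (hocc : ∀ i : SigIdx,
      (∃ y ∈ C.hatσ i, y ≠ 0 ∧ ∀ t : (printPlaces RP kind lam hlam vac).Tg,
          C.R (ιT t) y = printPlacesW RP kind lam hlam vac t • y) → D.wOccurs i) :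
    PrintedAnalyticSide C D P RP kind lam hlam vac :=
  letI : AddCommGroup SK := A.instSKacg
  letI : Module ℂ SK := A.instSKmod
  { ιT := ιT
    instSKacg := A.instSKacg
    instSKmod := A.instSKmod
    TΦc_add := A.TΦc_add
    TΦc_smul := A.TΦc_smul
    cont := A.cont
    FinIdx := A.FinIdx
    ins := A.ins
    dense := A.dense
    omg_ins := A.omg_ins
    invariance := A.invariance
    ιR := A.ιR
    XR := A.XR
    e := A.e
    he := A.he
    ladder_span := A.ladder_span
    hF := A.hF
    Sm := A.Sm
    Sm_sub := A.Sm_sub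
    Sm_dense := A.Sm_dense
    YR := A.YR
    YR_mem := A.YR_mem
    hH := A.hH
    wOccurs_of_eigenvector := hocc }

/-- Read-back: the rebuilt side's chart torus IS the parameter `ιT`. -/
theorem toSide_ιT (A : TorusFreeAnalyticSide C P RP kind lam hlam vac ιT) (D : TorusData C)
    (hocc : ∀ i : SigIdx,
      (∃ y ∈ C.hatσ i, y ≠ 0 ∧ ∀ t : (printPlaces RP kind lam hlam vac).Tg,
          C.R (ιT t) y = printPlacesW RP kind lam hlam vac t • y) → D.wOccurs i) :
    (A.toSide D hocc).ιT = ιT := rfl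

/-- **Lemma 4.1(c) from a torus-free side plus the occurrence inference** (pv12-g7 `PrintedAnalyticSide.H_occ`). -/
theorem H_occ (A : TorusFreeAnalyticSide C P RP kind lam hlam vac ιT) (D : TorusData C)
    (hocc : ∀ i : SigIdx,
      (∃ y ∈ C.hatσ i, y ≠ 0 ∧ ∀ t : (printPlaces RP kind lam hlam vac).Tg,
          C.R (ιT t) y = printPlacesW RP kind lam hlam vac t • y) → D.wOccurs i) :
    ∀ (Φ : SK) (i : SigIdx), (∃ v ∈ C.hatσ i, C.TΦ Φ v ≠ 0) → D.wOccurs i :=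
  (A.toSide D hocc).H_occ

/-- Conversely, every `PrintedAnalyticSide` is a torus-free side at its own chart torus. -/
def ofSide {D : TorusData C} (A : PrintedAnalyticSide C D P RP kind lam hlam vac) :
    TorusFreeAnalyticSide C P RP kind lam hlam vac A.ιT :=
  letI : AddCommGroup SK := A.instSKacg
  letI : Module ℂ SK := A.instSKmod
  { instSKacg := A.instSKacg
    instSKmod := A.instSKmod
    TΦc_add := A.TΦc_add
    TΦc_smul := A.TΦc_smul
    cont := A.cont
    FinIdx := A.FinIdx
    ins := A.ins
    dense := A.dense
    omg_ins := A.omg_ins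
    invariance := A.invariance
    ιR := A.ιR
    XR := A.XR
    e := A.e
    he := A.he
    ladder_span := A.ladder_span
    hF := A.hF
    Sm := A.Sm
    Sm_sub := A.Sm_sub
    Sm_dense := A.Sm_dense
    YR := A.YR
    YR_mem := A.YR_mem
    hH := A.hH }

/-- **Nothing else was dropped**: torus-free side + own chart torus + own occurrence field = the original record. -/
theorem toSide_ofSide {D : TorusData C} (A : PrintedAnalyticSide C D P RP kind lam hlam vac) :
    (ofSide A).toSide D A.wOccurs_of_eigenvector = A := rfl

end TorusFreeAnalyticSide

/-- **The S4 input a MODEL still has to supply**: `TorusFreeAnalyticSide` minus the two fields a kernel model over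
quotient models discharges by itself (this seat's `EndStateInvariance`): the continuity `cont` ([SETUP D4], from
`WeilThetaModel.θ_cont`) and the N21 field `invariance` (from `WeilThetaModel.θ_omg`).  TWENTY fields, verbatim. -/
structure ModelAnalyticSide (C : IsolationCore H HG CG G SK SigIdx SigIdxG) (P : C4a.PointedCore C)
    (RP : Type) [Fintype RP] [DecidableEq RP] (kind : RP → PlaceKind) (lam : RP → ℂ)
    (hlam : ∀ b, lam b ≠ 0) (vac : RP → (Circle × Circle →* Circle))
    (ιT : (printPlaces RP kind lam hlam vac).Tg →* G) where
  /-- [SETUP D4] the additive group structure of 𝒮^κ. -/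
  [instSKacg : AddCommGroup SK]
  /-- [SETUP D4] the ℂ-vector-space structure of 𝒮^κ. -/
  [instSKmod : Module ℂ SK]
  /-- [SETUP D4] Φ ↦ 𝒯_Φ is additive. -/
  TΦc_add : ∀ Φ Ψ : SK, C.TΦc (Φ + Ψ) = C.TΦc Φ + C.TΦc Ψ
  /-- [SETUP D4] Φ ↦ 𝒯_Φ is homogeneous. -/
  TΦc_smul : ∀ (c : ℂ) (Φ : SK), C.TΦc (c • Φ) = c • C.TΦc Φ
  /-- [SETUP D4] index of the fixed data at the other places: Φ_f ∈ 𝒮((V₃⊗W)(𝔸_f)). -/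
  FinIdx : Type
  /-- [SETUP D4] the pure tensor φ ↦ φ ⊗ Φ_f ∈ 𝒮^κ, linear in φ ∈ 𝓕^κ_∞ = ⊗_b 𝓕^{κ_b}_b (printed places). -/
  ins : FinIdx → (printPlaces RP kind lam hlam vac).F →ₗ[ℂ] SK
  /-- [SETUP D4/D5] the pure tensors span a dense subspace of 𝒮^κ (Reed–Simon I Thm V.13). -/
  dense : Dense (Submodule.span ℂ
    (Set.range fun q : FinIdx × (printPlaces RP kind lam hlam vac).F => ins q.1 q.2) : Set SK)
  /-- [SETUP D4] ω(t)(φ ⊗ Φ_f) = (ω_∞(t)φ) ⊗ Φ_f with ω_∞|_T = ⊗_b ω_{W,b}|_{T_b} (printed scalings, PINNED vacuum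
  characters = N26's dictionary `e_b(Ψ_i)`). -/
  omg_ins : ∀ (f : FinIdx) (t : (printPlaces RP kind lam hlam vac).Tg) (φ : (printPlaces RP kind lam hlam vac).F),
    C.omg (ιT t) (ins f φ) = ins f ((printPlaces RP kind lam hlam vac).ωT t φ)
  /-- [SETUP D5] index of a family of REAL directions X_j ∈ 𝔲(W)(L₀⊗ℝ). -/
  ιR : Type
  /-- [SETUP D5] ω_∞(X_j) on 𝓕^κ_∞. -/
  XR : ιR → (printPlaces RP kind lam hlam vac).F →ₗ[ℂ] (printPlaces RP kind lam hlam vac).F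
  /-- [SETUP D4] the one-parameter subgroups e_j(s) = exp(sX_j). -/
  e : ιR → ℝ → G
  /-- [SETUP D4] e_j(0) = 1. -/
  he : ∀ j, e j 0 = 1
  /-- [SETUP D5] every printed slot / ladder operator is a ℂ-combination of the real directions (Folland Prop. (4.49)). -/
  ladder_span : ∀ k : (printPlaces RP kind lam hlam vac).ιX,
    (printPlaces RP kind lam hlam vac).X k ∈ Submodule.span ℂ (Set.range XR)
  /-- [SETUP D5′, FRÉCHET-SMOOTH VECTOR composed with the bounded linear Φ ↦ 𝒯_Φ(·)(g)] derivative of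
  s ↦ 𝒯_{ω(e_j s)(φ⊗Φ_f)}(·)(g) at 0 with VALUE 𝒯_{(X_jφ)⊗Φ_f}(·)(g).  WARRANT (adv2g34-O14 / adv2g35-O14-R): Poulsen 1972
  Prop. 1.2 + Thm. 1.2 p. 93; (D_∞(μ|Mp), Goodman) = (𝒮, Schwartz) by Folland 1989 p. 165 (4.47) + Reed–Simon I App. to
  §V.3 Lemmas 1–2 / Thm. V.13 pp. 141–143 + Folland Thm. (4.45); Folland (4.45)/(4.49) for the VALUE dω(X_j) only. -/
  hF : ∀ (j : ιR) (f : FinIdx) (φ : (printPlaces RP kind lam hlam vac).F) (p : P.Pt),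
    HasDerivAt (fun s : ℝ => C4a.pointFunctional C P (C.omg (e j s) (ins f φ)) p)
      (C4a.pointFunctional C P (ins f (XR j φ)) p) 0
  /-- [SETUP D7] the smooth (Gårding) vectors of σ̂_i (Getz–Hahn Prop. 4.2.3). -/
  Sm : SigIdx → Set H
  /-- [SETUP D7] smooth vectors lie in σ̂_i. -/
  Sm_sub : ∀ i, Sm i ⊆ (C.hatσ i : Set H)
  /-- [SETUP D7] smooth vectors are dense in σ̂_i. -/
  Sm_dense : ∀ i, (C.hatσ i : Set H) ⊆ closure (Sm i)
  /-- [SETUP D7] the derived action dR(X_j) on smooth vectors (Getz–Hahn Lemma 4.2.2). -/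
  YR : ιR → H → H
  /-- [SETUP D7] smooth vectors are stable under dR(X_j). -/
  YR_mem : ∀ (j : ιR) (i : SigIdx), ∀ v ∈ Sm i, YR j v ∈ Sm i
  /-- [SETUP D7] s ↦ R(e_j s)v is differentiable at 0 with derivative dR(X_j)v on smooth vectors. -/
  hH : ∀ (j : ιR) (i : SigIdx), ∀ v ∈ Sm i, HasDerivAt (fun s : ℝ => C.R (e j s) v) (YR j v) 0

namespace ModelAnalyticSide

variable {C : IsolationCore H HG CG G SK SigIdx SigIdxG} {P : C4a.PointedCore C}
variable {RP : Type} [Fintype RP] [DecidableEq RP] {kind : RP → PlaceKind} {lam : RP → ℂ} {hlam : ∀ b, lam b ≠ 0}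
  {vac : RP → (Circle × Circle →* Circle)} {ιT : (printPlaces RP kind lam hlam vac).Tg →* G}

/-- The torus-free side REBUILT from a model side and proofs of the two dropped fields `cont`, `invariance`. -/
def toTorusFree (A : ModelAnalyticSide C P RP kind lam hlam vac ιT)
    (cont : ∀ (p : P.Pt) (v : H), Continuous fun Φ : SK => P.evalPt p (C.TΦc Φ v))
    (invariance : ∀ (h : G) (Φ : SK) (v : H), C.TΦc (C.omg h Φ) (C.R h v) = C.TΦc Φ v) :
    TorusFreeAnalyticSide C P RP kind lam hlam vac ιT :=
  letI : AddCommGroup SK := A.instSKacg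
  letI : Module ℂ SK := A.instSKmod
  { instSKacg := A.instSKacg
    instSKmod := A.instSKmod
    TΦc_add := A.TΦc_add
    TΦc_smul := A.TΦc_smul
    cont := cont
    FinIdx := A.FinIdx
    ins := A.ins
    dense := A.dense
    omg_ins := A.omg_ins
    invariance := invariance
    ιR := A.ιR
    XR := A.XR
    e := A.e
    he := A.he
    ladder_span := A.ladder_span
    hF := A.hF
    Sm := A.Sm
    Sm_sub := A.Sm_sub
    Sm_dense := A.Sm_dense
    YR := A.YR
    YR_mem := A.YR_mem
    hH := A.hH }

/-- Conversely, every torus-free side is a model side (forget `cont`, `invariance`). -/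
def ofTorusFree (A : TorusFreeAnalyticSide C P RP kind lam hlam vac ιT) : ModelAnalyticSide C P RP kind lam hlam vac ιT :=
  letI : AddCommGroup SK := A.instSKacg
  letI : Module ℂ SK := A.instSKmod
  { instSKacg := A.instSKacg
    instSKmod := A.instSKmod
    TΦc_add := A.TΦc_add
    TΦc_smul := A.TΦc_smul
    FinIdx := A.FinIdx
    ins := A.ins
    dense := A.dense
    omg_ins := A.omg_ins
    ιR := A.ιR
    XR := A.XR
    e := A.e
    he := A.he
    ladder_span := A.ladder_span
    hF := A.hF
    Sm := A.Sm
    Sm_sub := A.Sm_sub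
    Sm_dense := A.Sm_dense
    YR := A.YR
    YR_mem := A.YR_mem
    hH := A.hH }

/-- **Nothing else was dropped.** -/
theorem toTorusFree_ofTorusFree (A : TorusFreeAnalyticSide C P RP kind lam hlam vac ιT) :
    (ofTorusFree A).toTorusFree A.cont A.invariance = A := rfl

end ModelAnalyticSide

end TorusFree

end ArchC
end PerL34

/-! ## §2  On the END STATE: the canonical charts and the torus half of N29 as theorems -/

namespace Universe
namespace AdelicTorusCore

open HodgeCM.PerL34 HodgeCM.PerL34.ArchC HodgeCM.PerL34.Fock HodgeCM.PerL34.Fock.PrintDict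
open HodgeCM.Prior.Perl34File HodgeCM.Prior.Perl34File.Perl34
open NumberField NumberField.SeesawArchTorus

variable {U : Universe} {hP : PrintFact_unitaryCompact} (C : U.AdelicTorusCore hP)
  (R12 : ∀ {L : CMField} {ι₁ : L →+* ℂ} (V : HermSpace3 L ι₁) (c : SeesawCtx L), C.Rest12 V c)
  (R34 : ∀ {L : CMField} {ι₁ : L →+* ℂ} (V : HermSpace3 L ι₁) (c : SeesawCtx L), C.Rest34 V c)

section Charts


-- port_pkg: scope closed for this part
end Charts
end AdelicTorusCore
end Universe
end HodgeCM
end
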